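import Mathlib
import HarnessLib
import Literature.Computability.AlgebraicComplexity.PatternExpressions
import Summits.ValiantsHypothesis.ValiantsHypothesis.Theorems.MonotoneRestorationMonotoneRestorationQPLinearWidthDefs
import Summits.ValiantsHypothesis.ValiantsHypothesis.Theorems.MonotoneRestorationMonotoneRestorationQPLinearWidthDirectSumCongruence

/-!
# Route MonotoneRestoration, crux `MonotoneRestorationQP` (stmt-15886), line `linear_width` —
# LEVEL-DOWNWARD MONOTONICITY OF WEIGHTED DETERMINEDNESS (zero-extension)

Helper file (`--supports stmt-ValiantsHypothesis-15886`), def-free.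

`KroneckerDownward.determined_kroneckerRestrict` (p840708) says that weighted determinedness by `HomIndist · k` descends
from a PRODUCT level `m·ν` to the level `ν` (weighted `cl_{mν} ⊆ cl_ν`).  This file records the ADDITIVE companion, a
corollary of the zero-extension congruence `DirectSumCongruence.homIndist_zeroExtend`: determinedness descends from ANY
level `n ≥ ν` to the level `ν`, for formal combinations of homomorphism polynomials of isolated-vertex-free patterns read
with the SAME coefficients at both levels.

* `eval_sum_homPoly_zeroExtend` — the zero-extension `Z` of `z ∈ ℂ^{ν×ν}` along an injection `ι : Fin ν → Fin n`
  evaluates every such combination at level `n` to its value at `z` at level `ν`;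
* `exists_zeroExtend` — a zero-extension exists (it is `Function.extend (Prod.map ι ι) z 0`; stated in hypothesis form so
  that no definition is introduced);
* `determined_levelRestrict` — **LEVEL-DOWNWARD MONOTONICITY**: if `Σ_i α_i hom_{F_i,n}` is determined by `HomIndist n k`
  and `ν ≤ n` (an injection `Fin ν → Fin n`), then `Σ_i α_i hom_{F_i,ν}` is determined by `HomIndist ν k`;
* `homPoly_determined_levelRestrict` — one pattern: the weighted non-uniform homomorphism-distinguishing closure is
  antitone in the level, `cl_n(tw < k) ⊆ cl_ν(tw < k)` for isolated-vertex-free patterns and `ν ≤ n`;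
* `determined_levelRestrict_le` — the same with the hypothesis `ν ≤ n` (injection `Fin.castLE`).

Honest label: bookkeeping corollary of zero-extension; with `homIndist_directSum` the additive isolation at level `ν + m`
yields, for CONNECTED patterns, exactly this and nothing more (the `y`-block contributions cancel identically), so the
residue (GIANT) of the rung named in KRONECKER-MONOTONICITY-g11.md is untouched.  No stub closed; the rung, the cruxes
and VP ≠ VNP are NOT moved.
[cite: DawarPagoSeppelt2025, §7.1.1, Thm 7.11; DwivediPagoSeppelt2026, eq. (1)]
-/

set_option linter.dupNamespace false

noncomputable section

open scoped Classical

namespace Summit.ValiantsHypothesis.ValiantsHypothesis.Theorems.LevelDownward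

open MvPolynomial Finset
open Literature.Computability.AlgebraicComplexity
open Summit.ValiantsHypothesis.ValiantsHypothesis.Theorems.MonotoneRestorationQPLinearWidth
open Summit.ValiantsHypothesis.ValiantsHypothesis.Theorems.DirectSumCongruence

variable {n : ℕ}

/-- **Zero-extension reads a formal combination of isolated-vertex-free patterns one level down**: if `Z` of level `n`
reads `z` on `ι × ι` and vanishes off it, then `Σ_i α_i hom_{F_i,n}(Z) = Σ_i α_i hom_{F_i,ν}(z)`. [folklore] -/
theorem eval_sum_homPoly_zeroExtend {ν : ℕ} (ι : Fin ν → Fin n) (hι : Function.Injective ι)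
    {z : Fin ν × Fin ν → ℂ} {Z : Fin n × Fin n → ℂ}
    (hZ : ∀ i j, Z (ι i, ι j) = z (i, j)) (hZ0 : ∀ p q, Z (p, q) ≠ 0 → (∃ i, ι i = p) ∧ ∃ j, ι j = q)
    {M : ℕ} (a b : Fin M → ℕ) (E : (i : Fin M) → Multiset (Fin (a i) × Fin (b i))) (α : Fin M → ℂ)
    (hrow : ∀ i (u : Fin (a i)), ∃ x ∈ E i, x.1 = u) (hcol : ∀ i (v : Fin (b i)), ∃ x ∈ E i, x.2 = v) :
    eval Z (∑ i, C (α i) * homPoly (E i) n ℂ) = eval z (∑ i, C (α i) * homPoly (E i) ν ℂ) := by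
  rw [map_sum, map_sum]
  refine Finset.sum_congr rfl fun i _ => ?_
  rw [map_mul, map_mul, eval_C, eval_C, eval_homPoly_zeroExtend ι hι hZ hZ0 (E i) (hrow i) (hcol i)]

/-- **A zero-extension along an injection exists** (hypothesis form: a weighting of level `n` reading `z` on `ι × ι`
and vanishing off it). [folklore] -/
theorem exists_zeroExtend {ν : ℕ} (ι : Fin ν → Fin n) (hι : Function.Injective ι) (z : Fin ν × Fin ν → ℂ) :
    ∃ Z : Fin n × Fin n → ℂ, (∀ i j, Z (ι i, ι j) = z (i, j)) ∧
      ∀ p q, Z (p, q) ≠ 0 → (∃ i, ι i = p) ∧ ∃ j, ι j = q := by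
  have hι₂ : Function.Injective (Prod.map ι ι) := hι.prodMap hι
  refine ⟨Function.extend (Prod.map ι ι) z 0, fun i j => ?_, fun p q hne => ?_⟩
  · exact hι₂.extend_apply z 0 (i, j)
  · by_contra hnot
    apply hne
    rw [Function.extend_apply']
    · rfl
    · rintro ⟨⟨i, j⟩, hij⟩
      simp only [Prod.map_apply, Prod.mk.injEq] at hij
      exact hnot ⟨⟨i, hij.1⟩, j, hij.2⟩

/-- **LEVEL-DOWNWARD MONOTONICITY OF WEIGHTED DETERMINEDNESS.**  Let `p^{(ℓ)} = Σ_i α_i hom_{F_i,ℓ}` be a formal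
combination of homomorphism polynomials of isolated-vertex-free bipartite patterns, read at every level `ℓ` with the same
coefficients, and let `ι : Fin ν → Fin n` be injective.  If `p^{(n)}` is determined by `HomIndist n k` on `ℂ^{n×n}`, then
`p^{(ν)}` is determined by `HomIndist ν k` on `ℂ^{ν×ν}` (evaluate at zero-extensions, which are `HomIndist n k`-related
by `homIndist_zeroExtend`). [cite: DawarPagoSeppelt2025, §7.1.1] -/
theorem determined_levelRestrict {ν k M : ℕ} (ι : Fin ν → Fin n) (hι : Function.Injective ι)
    (a b : Fin M → ℕ) (E : (i : Fin M) → Multiset (Fin (a i) × Fin (b i))) (α : Fin M → ℂ)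
    (hrow : ∀ i (u : Fin (a i)), ∃ x ∈ E i, x.1 = u) (hcol : ∀ i (v : Fin (b i)), ∃ x ∈ E i, x.2 = v)
    (hdet : ∀ A B : Fin n × Fin n → ℂ, HomIndist n k A B →
      eval A (∑ i, C (α i) * homPoly (E i) n ℂ) = eval B (∑ i, C (α i) * homPoly (E i) n ℂ))
    {z z' : Fin ν × Fin ν → ℂ} (h : HomIndist ν k z z') :
    eval z (∑ i, C (α i) * homPoly (E i) ν ℂ) = eval z' (∑ i, C (α i) * homPoly (E i) ν ℂ) := by
  obtain ⟨Z, hZ, hZ0⟩ := exists_zeroExtend ι hι z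
  obtain ⟨Z', hZ', hZ'0⟩ := exists_zeroExtend ι hι z'
  rw [← eval_sum_homPoly_zeroExtend ι hι hZ hZ0 a b E α hrow hcol,
    ← eval_sum_homPoly_zeroExtend ι hι hZ' hZ'0 a b E α hrow hcol]
  exact hdet Z Z' (homIndist_zeroExtend ι hι hZ hZ0 hZ' hZ'0 h)

/-- **The weighted homomorphism-distinguishing closure is antitone in the level** (one pattern): if the isolated-vertex-
free pattern `F` is determined by `HomIndist n k` at level `n` and `ι : Fin ν → Fin n` is injective, then `F` is determined
by `HomIndist ν k` at level `ν` — `cl_n(tw < k) ⊆ cl_ν(tw < k)`. [cite: DawarPagoSeppelt2025, §7.1.1] -/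
theorem homPoly_determined_levelRestrict {ν k a b : ℕ} (ι : Fin ν → Fin n) (hι : Function.Injective ι)
    (F : Multiset (Fin a × Fin b)) (hrow : ∀ u, ∃ x ∈ F, x.1 = u) (hcol : ∀ v, ∃ x ∈ F, x.2 = v)
    (hdet : ∀ A B : Fin n × Fin n → ℂ, HomIndist n k A B → eval A (homPoly F n ℂ) = eval B (homPoly F n ℂ))
    {z z' : Fin ν × Fin ν → ℂ} (h : HomIndist ν k z z') :
    eval z (homPoly F ν ℂ) = eval z' (homPoly F ν ℂ) := by
  obtain ⟨Z, hZ, hZ0⟩ := exists_zeroExtend ι hι z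
  obtain ⟨Z', hZ', hZ'0⟩ := exists_zeroExtend ι hι z'
  rw [← eval_homPoly_zeroExtend ι hι hZ hZ0 F hrow hcol, ← eval_homPoly_zeroExtend ι hι hZ' hZ'0 F hrow hcol]
  exact hdet Z Z' (homIndist_zeroExtend ι hι hZ hZ0 hZ' hZ'0 h)

/-- **Level-downward monotonicity, order form**: for `ν ≤ n` (injection `Fin.castLE`), determinedness of
`Σ_i α_i hom_{F_i,n}` by `HomIndist n k` gives determinedness of `Σ_i α_i hom_{F_i,ν}` by `HomIndist ν k`.
[cite: DawarPagoSeppelt2025, §7.1.1] -/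
theorem determined_levelRestrict_le {ν k M : ℕ} (hνn : ν ≤ n)
    (a b : Fin M → ℕ) (E : (i : Fin M) → Multiset (Fin (a i) × Fin (b i))) (α : Fin M → ℂ)
    (hrow : ∀ i (u : Fin (a i)), ∃ x ∈ E i, x.1 = u) (hcol : ∀ i (v : Fin (b i)), ∃ x ∈ E i, x.2 = v)
    (hdet : ∀ A B : Fin n × Fin n → ℂ, HomIndist n k A B →
      eval A (∑ i, C (α i) * homPoly (E i) n ℂ) = eval B (∑ i, C (α i) * homPoly (E i) n ℂ))
    {z z' : Fin ν × Fin ν → ℂ} (h : HomIndist ν k z z') :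
    eval z (∑ i, C (α i) * homPoly (E i) ν ℂ) = eval z' (∑ i, C (α i) * homPoly (E i) ν ℂ) :=
  determined_levelRestrict (Fin.castLE hνn) (Fin.castLE_injective hνn) a b E α hrow hcol hdet h

end Summit.ValiantsHypothesis.ValiantsHypothesis.Theorems.LevelDownward

end
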